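import Summits.BirchSwinnertonDyer.BirchSwinnertonDyer.Theorems.AdditiveRankOneLowerHalfOfUnrFrameControlLe
import Summits.BirchSwinnertonDyer.BirchSwinnertonDyer.Theorems.UniversalToricDescentWildSplitFrameAtThreeOddOfPrintOfEngine
import Summits.BirchSwinnertonDyer.BirchSwinnertonDyer.Theses.SemiOrdinaryEisensteinDescent
import HarnessLib

/-!
# The r = 1 LOWER half at an additive prime from an `R₀`-frame and the `R₀`-Eisenstein inclusion, RE-KEYED to the
# LIVE items: the frame supply at ODD `d_K` (UTD support 24475 `WildSplitFrameAtThreeOddOfPrint`, CLOSED·proved) and the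
# RESTRICTED Eisenstein inclusion E′ (SOED crux 24155 `WildSplitEisensteinInclusionAtThreeRestricted`, BY NAME)

Cell `bsd-wall` (W-ALL row 2·3@3, lane 3), width seat `bsd-wall-soed-p1-w3` (prover, gen 7), 2026-08-28. Sequel of
utd-p3 g6's `Theorems/AdditiveRankOneLowerHalfOfUnrFrameControlLe.lean` (p593693), whose §3 reads K9's LOWER half on the
tower-surjective wild rank-one rows off the TEXTS of two items that are now ASIDE on their routes: UTD's frame child
`WildSplitFrameAtThree` (stmt-20928; frame at EVERY Heegner field) and SOED's Eisenstein inclusion E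
`WildSplitEisensteinInclusionAtThree` (stmt-20479; inclusion at EVERY frame). Both routes re-keyed (UTD rev 27/28, SOED revs
6–14) to
* 24475 `WildSplitFrameAtThreeOddOfPrint` = Hsieh 2014 Thm A (any level) → BDP 2013 central-value reciprocity → the frame
  supply at every Heegner field with ODD `d_K` — CLOSED·proved (`Theorems.wildSplitFrameAtThreeOddOfPrint_proof`, utd-s1 g0
  p596578 over soed-p1-w2 g7's engine p595848), and
* 24155 `WildSplitEisensteinInclusionAtThreeRestricted` (E′) = the inclusion at the frames of a Heegner DATUM `(H, ι, P)` with
  `L(E^(d_K), 1) ≠ 0` and `P = y_K` non-torsion (open research crux; walls W1–W3 of `Cruxes/WildSplitEisensteinInclusionAtThree/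
  Lines/birth-dead*.md`).
p593693 §2 already passes the datum `(N, K, Dt, H, ι, P)` with `Odd d_K`, `d_K < -4`, `L(E^(d_K),1) ≠ 0`, `P = y_K`,
`P` non-torsion to its index-lower-bound step (`missingLowerBoundAt_of_indexLower_of_twistUpperOdd_row`) and merely did not
forward `Odd d_K` to the frame supplier nor the datum to the inclusion; this file forwards them. Nothing else changes.

* §1 `missingLowerBoundAt_of_unrFrameOdd_of_unrEisensteinRestricted_of_controlLe_of_twistUpper_row` — p593693 §2 with the
  frame supplier asked only at odd `d_K` (24475's conclusion shape, one curve) and the inclusion asked only at the datum's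
  frames (E′'s shape, one curve). Row-local, any odd additive `p`.
* §2 `missingLowerBoundAt_wildRankOne_towerSurj_of_print_of_eisensteinRestricted_of_katoTam_of_poitouTate` — p593693 §3
  with `hFr` DISCHARGED by the closed item 24475 (modulo its two print antecedents Hsieh Thm A / BDP 2013, displayed) and
  `hX` := E′ BY NAME: K9's 19200 LOWER half on the tower-surjective wild r = 1 rows ⟸ E′ ∧ A161″ ∧ PT1 ∧ LZZ ∧ Hsieh A ∧
  BDP13 ∧ ToricPublishedInputs.

HONEST FRAMING: CONDITIONAL on every displayed hypothesis (one open research crux E′, Kato A161″, four print named facts, the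
parametrised published inputs); theorems only; closes nothing; BSD₃ for no curve. The UPPER half is not touched.

References: [Castella2018] Thm 3.1, §3; [JetchevSkinnerWan2017] §7.4.1, Thm. 3.3.1; [LiuZhangZhang2018] Thm 1.5.1/1.5.3;
[Kato2004Asterisque] Thm. 14.5 (3), Prop. 14.16 (2); [MilneADT2006] I Thm. 4.10(b); [GrossZagier1986] I.(6.3); [Kolyvagin1990]
Thm. A; [Hsieh2014] Thm. A; [BertoliniDarmonPrasanna2013] Thm. 5.13.
-/

noncomputable section

open scoped Classical

set_option linter.dupNamespace false -- `Summit.BirchSwinnertonDyer.BirchSwinnertonDyer.Theorems.…` (summit = sub, D-0017)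
set_option autoImplicit false

namespace Summit.BirchSwinnertonDyer.BirchSwinnertonDyer.Theorems.AdditiveRankOneLowerHalfControlLeOfPrint

open WeierstrassCurve NumberField IsDedekindDomain Field PowerSeries
  Literature.NumberTheory.EllipticCurves
  Literature.NumberTheory.EllipticCurves.ModularForms
  Literature.NumberTheory.EllipticCurves.Rank1Residual
  Literature.NumberTheory.EllipticCurves.Rank1Residual.Typed
  Literature.NumberTheory.EllipticCurves.KrizLi2019
  Literature.NumberTheory.GaloisRepresentations
  Literature.NumberTheory.GaloisCohomology
  Summit.BirchSwinnertonDyer.Rank1Residual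
  Summit.BirchSwinnertonDyer.Rank1Residual.Additive
  Summit.BirchSwinnertonDyer.Rank1Residual.X11b
  Summit.BirchSwinnertonDyer.Rank1Residual.X11b.AcSelmer
  Summit.BirchSwinnertonDyer.Rank1Residual.X11b.Halves
  Summit.BirchSwinnertonDyer.Rank1Residual.X11b.CongruenceLimit
  Summit.BirchSwinnertonDyer.BirchSwinnertonDyer.Theses.UniversalToricDescent
  Summit.BirchSwinnertonDyer.BirchSwinnertonDyer.Theorems.AdditivePotSupersingularControl
  Summit.BirchSwinnertonDyer.BirchSwinnertonDyer.Theorems.UniversalToricDescentWaldspurgerFlat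
  Summit.BirchSwinnertonDyer.BirchSwinnertonDyer.Theorems.SchneiderFreeControlAtoms
  Summit.BirchSwinnertonDyer.BirchSwinnertonDyer.Theorems.AdditiveRankOneControlLe
  Summit.BirchSwinnertonDyer.BirchSwinnertonDyer.Theorems.AdditiveRankOneLowerHalfControlLe

/-! ## §1 The row-local r = 1 LOWER half, frame supply at odd `d_K`, inclusion at the datum's frames -/

/-- **The row-local r = 1 LOWER half `MissingLowerBoundAt W p` at ANY odd additive prime from an `R₀`-frame supply asked
only at Heegner fields with ODD discriminant, the `R₀`-Eisenstein inclusion asked only at the frames of a Heegner DATUM with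
`L(E^(d_K),1) ≠ 0` and non-torsion `y_K` (torsion-guarded), the control INEQUALITY and the twists' r = 0 UPPER half** —
p593693 §2 `missingLowerBoundAt_of_unrFrame_of_unrEisenstein_of_controlLe_of_twistUpper_row` with `hFr` given the extra
antecedent `Odd (NumberField.discr K)` (the shape of UTD 24475's conclusion at one curve) and `hIncl` given the datum binders
`(H, ι, P)`, `L(E^(d_K),1) ≠ 0`, `P ↦ y_K`, `¬ IsOfFinAddOrder P` (the shape of SOED E′ 24155 at one curve); the proof is
the same composition `missingLowerBoundAt_of_indexLower_of_twistUpperOdd_row ∘ p593693 §1`, whose datum callback already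
carries `Odd d_K` and the datum. CONDITIONAL; closes nothing.
[cite: JetchevSkinnerWan2017, §7.4.1 (arXiv:1512.06894 p. 30)] [cite: Castella2018, Thm. 3.1 and §3 (arXiv:1704.06608 pp. 8–9)]
[cite: GrossZagier1986, I.(6.3)] -/
theorem missingLowerBoundAt_of_unrFrameOdd_of_unrEisensteinRestricted_of_controlLe_of_twistUpper_row (p : ℕ) [Fact p.Prime]
    (hp2 : p ≠ 2) (hL : LiuZhangZhang2018.thm151_thm153_modularCurve_heegnerVector_additive) (hF : ToricPublishedInputs)
    (W : WeierstrassCurve ℚ) [W.IsElliptic] [W.IsGloballyMinimal] (haddv : Addv W p) (hr : W.analyticRank = 1)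
    (hFr : ∀ (N : ℕ) [NeZero N] (K : Type) [Field K] [NumberField K] (Dt : ModularParametrizationData W N),
      W.conductorNorm ℤ = N → IsImaginaryQuadratic K → SatisfiesHeegnerHypothesis N K → Odd (NumberField.discr K) →
      ∀ (κ : ZpExtension K p), κ.IsAnticyclotomic → ∀ (γ : Field.absoluteGaloisGroup K) [Fact (κ.IsTopGenerator γ)]
        (𝔭 : HeightOneSpectrum (𝓞 K)), ((p : ℕ) : 𝓞 K) ∈ 𝔭.asIdeal →
        ∃ ι' : PadicAlgCl p ≃+* ℂ, SchneiderFree.BranchInducesPrime p ι' 𝔭 ∧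
          ∃ (ΩK : ℂ) (Ωp : ℂ_[p]) (L : UnrSeries p), ΩK ≠ 0 ∧ Ωp ≠ 0 ∧ IsBDPLFunction ι' 𝔭 κ γ Dt.f ΩK Ωp L)
    (hIncl : ∀ (N : ℕ) [NeZero N] (K : Type) [Field K] [NumberField K] (Dt : ModularParametrizationData W N)
      (H : HeegnerDatum N (NumberField.discr K)) (ι : K →+* ℂ) (P : (W.baseChange K).toAffine.Point),
      W.conductorNorm ℤ = N → IsImaginaryQuadratic K → SatisfiesHeegnerHypothesis N K →
      (W.quadraticTwist (NumberField.discr K : ℚ)).entireLFunction 1 ≠ 0 →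
      WeierstrassCurve.Affine.Point.map ι.toRatAlgHom P = heegnerPointComplex Dt H → ¬ IsOfFinAddOrder P →
      ∀ (κ : ZpExtension K p), κ.IsAnticyclotomic → ∀ (γ : Field.absoluteGaloisGroup K) [Fact (κ.IsTopGenerator γ)]
        (𝔭 : HeightOneSpectrum (𝓞 K)), ((p : ℕ) : 𝓞 K) ∈ 𝔭.asIdeal → 𝔭.asIdeal.ramificationIdx (𝓞 ℚ) = 1 →
        𝔭.asIdeal.inertiaDeg (𝓞 ℚ) = 1 → ∀ (𝔭' : HeightOneSpectrum (𝓞 K)), ((p : ℕ) : 𝓞 K) ∈ 𝔭'.asIdeal → 𝔭' ≠ 𝔭 →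
        ∀ (ι' : PadicAlgCl p ≃+* ℂ), SchneiderFree.BranchInducesPrime p ι' 𝔭 →
        ∀ (ΩK : ℂ) (Ωp : ℂ_[p]) (L : UnrSeries p), ΩK ≠ 0 → Ωp ≠ 0 → IsBDPLFunction ι' 𝔭 κ γ Dt.f ΩK Ωp L →
          Module.IsTorsion (IwasawaAlgebra p) (XAc (W.baseChange K) p κ 𝔭' ∅ γ) →
          (XAc.charIdeal (W.baseChange K) p κ 𝔭' ∅ γ).map (PowerSeries.map (toUnr p)) ≤ Ideal.span {L})
    (hCtl : ∀ (N : ℕ) [NeZero N] (K : Type) [Field K] [NumberField K] (Dt : ModularParametrizationData W N)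
      (H : HeegnerDatum N (NumberField.discr K)) (ι : K →+* ℂ) (P : (W.baseChange K).toAffine.Point),
      W.conductorNorm ℤ = N → IsImaginaryQuadratic K → SatisfiesHeegnerHypothesis N K →
      (W.quadraticTwist (NumberField.discr K : ℚ)).entireLFunction 1 ≠ 0 →
      WeierstrassCurve.Affine.Point.map ι.toRatAlgHom P = heegnerPointComplex Dt H → ¬ IsOfFinAddOrder P →
      Literature.NumberTheory.EllipticCurves.kolyvagin N W K →
      ∀ (κ : ZpExtension K p), κ.IsAnticyclotomic → ∀ (γ : Field.absoluteGaloisGroup K) [Fact (κ.IsTopGenerator γ)]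
        (𝔭 : HeightOneSpectrum (𝓞 K)) (h𝔭 : ((p : ℕ) : 𝓞 K) ∈ 𝔭.asIdeal) (he : 𝔭.asIdeal.ramificationIdx (𝓞 ℚ) = 1)
        (hf : 𝔭.asIdeal.inertiaDeg (𝓞 ℚ) = 1),
        AdditiveControlLeOnTreeAt p κ 𝔭 γ (embAt K p 𝔭 h𝔭 he hf) 0 P)
    (hTwUp : ∀ (N : ℕ) [NeZero N] (K : Type) [Field K] [NumberField K]
      (Wd : WeierstrassCurve ℚ) [Wd.IsElliptic] [Wd.IsGloballyMinimal],
      W.conductorNorm ℤ = N → IsImaginaryQuadratic K → SatisfiesHeegnerHypothesis N K → Odd (NumberField.discr K) →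
      NumberField.discr K < -4 → (∃ C : VariableChange ℚ, C • W.quadraticTwist (NumberField.discr K : ℚ) = Wd) →
      (W.quadraticTwist (NumberField.discr K : ℚ)).entireLFunction 1 ≠ 0 → MissingUpperBoundAt Wd p) :
    MissingLowerBoundAt W p := by
  have hKo : ∀ (N : ℕ) [NeZero N] (W : WeierstrassCurve ℚ) (K : Type) [Field K] [NumberField K],
      Literature.NumberTheory.EllipticCurves.kolyvagin N W K := hF.2.1
  refine missingLowerBoundAt_of_indexLower_of_twistUpperOdd_row p hp2 hF W haddv hr ?_ hTwUp
  intro N _ K _ _ Dt H ι P hN hK hHN hodd hd4 hLt hP hnt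
  exact indexLowerBoundLeAt_of_unrFrame_of_unrInclLe_of_controlLe hp2 hL Dt H ι P haddv hN hK hHN hd4 hP hnt (hKo N W K)
    (fun κ hκ γ _ 𝔭 h𝔭 ↦ hFr N K Dt hN hK hHN hodd κ hκ γ 𝔭 h𝔭)
    (fun κ hκ γ _ 𝔭 h𝔭 he hf 𝔭' h𝔭' hne ι' hind ΩK Ωp L hΩK hΩp hBDP htors ↦
      hIncl N K Dt H ι P hN hK hHN hLt hP hnt κ hκ γ 𝔭 h𝔭 he hf 𝔭' h𝔭' hne ι' hind ΩK Ωp L hΩK hΩp hBDP htors)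
    (fun κ hκ γ _ 𝔭 h𝔭 he hf ↦ hCtl N K Dt H ι P hN hK hHN hLt hP hnt (hKo N W K) κ hκ γ 𝔭 h𝔭 he hf)

/-! ## §2 K9's 19200 LOWER half on the tower-surjective wild rows from 24475 (closed) and E′ (BY NAME) -/

/-- **The LOWER half of K9's residual `WildRankOne` (stmt-BirchSwinnertonDyer-19200) on the `3`-adic TOWER-SURJECTIVE wild
rank-one rows from the LIVE items of UTD / SOED** — p593693 §3
`missingLowerBoundAt_wildRankOne_towerSurj_of_frame20928_of_eisenstein20479_of_katoTam_of_poitouTate` re-keyed: its frame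
hypothesis `hFr` (the text of the aside item 20928) is DISCHARGED by UTD's CLOSED support item 24475
`WildSplitFrameAtThreeOddOfPrint` (`Theorems.wildSplitFrameAtThreeOddOfPrint_proof`) modulo that item's two print
antecedents, displayed here (`hHsieh` = Hsieh 2014 Thm A at any level, `hBDP` = BDP 2013 central-value reciprocity); its
inclusion hypothesis `hX` (the text of the aside crux E 20479) is replaced by SOED's crux of record E′
`Theses.SemiOrdinaryEisensteinDescent.WildSplitEisensteinInclusionAtThreeRestricted` (stmt-BirchSwinnertonDyer-24155) BY NAME
— the frames E′ speaks about (odd `d_K` is where 24475 supplies them; `L(E^(d_K),1) ≠ 0`, `y_K` non-torsion) are exactly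
the frames §1's datum callback visits. Conclusion unchanged: `∀ W, r_an = 1 → ClassO6 W 3 → TowerSurjThree W →
MissingLowerBoundAt W 3` ⟸ E′ ∧ A161″ ∧ PT1 ∧ LZZ ∧ Hsieh A ∧ BDP13 ∧ ToricPublishedInputs. CONDITIONAL on every displayed
hypothesis (E′ is an OPEN research crux); closes nothing; BSD₃ for no curve.
[cite: JetchevSkinnerWan2017, §7.4.1 and Thm. 3.3.1 (arXiv:1512.06894)] [cite: Castella2018, Thm. 3.1 and §3 (arXiv:1704.06608 pp. 8–9)]
[cite: Kato2004Asterisque, Thm. 14.5 (3), Prop. 14.16 (2)] [cite: LiuZhangZhang2018, Thm 1.5.1 and Thm 1.5.3 (Duke Math. J. 167 pp. 748–749)]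
[cite: MilneADT2006, Ch. I, Thm. 4.10(b)] [cite: Hsieh2014, Thm. A] [cite: BertoliniDarmonPrasanna2013, Thm. 5.13] -/
theorem missingLowerBoundAt_wildRankOne_towerSurj_of_print_of_eisensteinRestricted_of_katoTam_of_poitouTate
    [Fact (3 : ℕ).Prime]
    (hL : LiuZhangZhang2018.thm151_thm153_modularCurve_heegnerVector_additive)
    (hF : ToricPublishedInputs)
    (hKatoT : Kato2004.rankZero_padicValNat_sha_add_padicValNat_tamagawa_le_of_additive_potGood_of_imageContainsSL2)
    (hPT : ∀ (K : Type) [Field K] [NumberField K], poitouTate_selmerStructure_duality K)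
    (hHsieh : Hsieh2014.thmA_exists_isHsiehLFunction_unrPeriod_anyLevel)
    (hBDP : bertoliniDarmonPrasanna2013_centralValue_reciprocity)
    (hE : Theses.SemiOrdinaryEisensteinDescent.WildSplitEisensteinInclusionAtThreeRestricted) :
    ∀ (W : WeierstrassCurve ℚ) [W.IsElliptic] [W.IsGloballyMinimal], W.analyticRank = 1 → ClassO6 W 3 →
      AdditiveThree.TowerSurjThree W → MissingLowerBoundAt W 3 := by
  intro W _ _ hr hO6 hT
  have hsurj := forall_hasSurjectiveModNGaloisRep_pow_three_of_towerSurjThree W hT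
  have h1 : W.HasSurjectiveModNGaloisRep 3 := by
    have h := hsurj 1
    simp only [pow_one] at h
    exact_mod_cast h
  have haddv : Addv W 3 := hO6.2.1
  have hj : 0 ≤ padicValRat 3 W.j := hO6.padicValRat_j_nonneg
  have hGZK : rank_eq_analyticRank_of_analyticRank_le_one := hF.2.2.1
  have hmod : hasEntireLFunction_rat := hF.2.2.2.1
  have hFr := wildSplitFrameAtThreeOddOfPrint_proof hHsieh hBDP
  exact missingLowerBoundAt_of_unrFrameOdd_of_unrEisensteinRestricted_of_controlLe_of_twistUpper_row 3 (by decide) hL hF W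
    haddv hr
    (fun N _ K _ _ Dt hN hK hHN hodd κ hκ γ _ 𝔭 h𝔭 ↦ hFr W N K Dt hO6 hN hK hHN hodd κ hκ γ 𝔭 h𝔭)
    (fun N _ K _ _ Dt H ι P hN hK hHN hLt hP hnt κ hκ γ _ 𝔭 h𝔭 he hf 𝔭' h𝔭' hne ι' hind ΩK Ωp L hΩK hΩp hBDP' htors ↦
      hE W N K Dt H ι P hO6 h1 hr hN hK hHN hLt hP hnt κ hκ γ 𝔭 h𝔭 he hf 𝔭' h𝔭' hne ι' hind ΩK Ωp L hΩK hΩp hBDP' htors)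
    (fun N _ K _ _ Dt H ι P hN hK hHN _hLt hP hnt hKo κ hκ γ _ 𝔭 h𝔭 he hf ↦
      additiveControlLeOnTreeAt_of_poitouTate_of_heegner W 3 (by decide) haddv N K (hPT K) Dt H ι P hN hK hHN hP hnt
        hKo κ hκ γ 𝔭 h𝔭 he hf)
    (fun N _ K _ _ Wd _ _ hN hK hHN _hodd _hd4 hC hLt ↦
      missingUpperBoundAt_twist_of_towerSurj_of_katoTam 3 (by decide) hKatoT hGZK hmod W haddv hj hsurj hN K hK hHN Wd hC hLt)

end Summit.BirchSwinnertonDyer.BirchSwinnertonDyer.Theorems.AdditiveRankOneLowerHalfControlLeOfPrint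

end
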